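/-
Copyright (c) 2026. All rights reserved.
Released under Apache 2.0 license as described in the file LICENSE.
Authors: abc-iut cell — seat abc-iut-w6-d031 (gen 2; block C / W6, row «COR27f-MODEL», L4 RULING #7m),
over abc-iut-L4-t12's `HolomorphicEllipticCuspidalization.lean` and the `ComplexTorus` library.
-/
import Literature.AnabelianGeometry.AbsoluteAnabelian.HolomorphicEllipticCuspidalizationTorsionHolds
import HarnessLib

/-!
# [AbsTopIII] Cor 2.7 (f) «functoriality w.r.t. finite étale morphisms» AT THE MODEL FAMILY, I:
# isogenies, the coverings `[N] : 𝕌_N → 𝔼`, and their deck translations (MODEL-LEVEL)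

S. Mochizuki, *Topics in absolute anabelian geometry III*, §2, Corollary 2.7, kurims p. 60 l. 15–16
(J. Math. Sci. Univ. Tokyo **22** (2015) p. 1017; bib key `MochizukiAbsTopIII2015`), the closing sentence
of the statement, read on the page: «Finally, the asserted “functoriality” is with respect to finite étale
morphisms of Aut-holomorphic orbispaces arising from hyperbolic orbicurves over ℂ.»  Item (f) is UNTYPED
in the statement of record `ArchimedeanReconstruction.lean` (p408225); the cell's Cor 2.7 table
(abc-iut-L4-t8, 2026-08-26) records only its ISOMORPHISM case for the torsion points, sub-node (c).5
`CuspidalTorsionPointsTransport` (PROVED, p416164).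

PROOF-ONLY companion (kind = proof: no definition, no named fact, nothing restated; label
**MODEL-LEVEL**) of `HolomorphicEllipticCuspidalization.lean` (p414370), part I of two (part II,
`HolomorphicEllipticCuspidalizationFunctorialityGroupLaw.lean`: the isomorphism case WITH the group laws
of (c), and the paragraph «what a full (f) would need»).  At the cell's MODEL FAMILY of punctured complex
tori `𝔼_Φ = T_Φ ∖ {0}`, `T_Φ = ℂ/Φ(ℤ^ι)` (`puncturedTorus Φ`; every typed punctured elliptic curve is
biholomorphic to one of them, (c).4 `puncturedEllipticCurveModel_holds`), this part treats the
NON-INVERTIBLE finite étale maps the tree has — the covering legs `[N] : 𝕌_N → 𝔼` of the elliptic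
cuspidalization diagrams of (b) (`nsmulCov`), their deck transformations (= translations by `T[N]`,
(b).3♯ p415902), and, more generally, every additive map `f : T_{Φ'} → T_Φ` with finite kernel (every
isogeny; its restriction `T_{Φ'} ∖ f⁻¹(0) → 𝔼_Φ` is, for `f` holomorphic and onto, a finite étale map of
punctured elliptic curves with several punctures):

* §1 torsion bookkeeping in abelian groups (private: an additive map with finite kernel, `N • −` for
  `N ≠ 0`, and translation by a torsion element reflect and preserve finite order);
* §2 such maps PULL BACK AND PUSH FORWARD the cuspidal torsion points of (b)
  (`mem_cuspidalTorsionPoints_map_iff_of_finite_ker`; for `[N]`: `nsmulCov_mem_cuspidalTorsionPoints_iff`,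
  `preimage_nsmulCov_cuspidalTorsionPoints`, and ONTO: `image_nsmulCov_cuspidalTorsionPoints`, by the
  divisibility of `T = (ℝ/ℤ)^ι`); the deck transformations preserve them
  (`mem_cuspidalTorsionPoints_deck_iff` — «the group structure on these torsion points [which is induced
  by the group structure of the Galois group `Gal(U/E)`]»); `[N]` is compatible with the group law of
  `T ⊃ 𝔼`, the group law of (c) at the model (`coe_nsmulCov_add`).

Everything rests on (b).eq `mem_cuspidalTorsionPoints_iff` (`HolomorphicEllipticCuspidalizationTorsionHolds.lean`, abc-iut-w5-d053 / w5-d208: the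
cuspidal torsion points of `𝔼_Φ` ARE the non-zero torsion points of `T_Φ`), consumed BY NAME.
HONEST FRAMING: model-level ≠ node-level; OUR proofs about OUR typing of a refereed pre-IUT statement;
typed ≠ endorsed; nothing here bears on the disputed [IUTchIII] Cor. 3.12; no side taken.
-/

noncomputable section

namespace Literature.AnabelianGeometry.AbsoluteAnabelian

namespace HolomorphicEllipticCuspidalization

open _root_.TopologicalSpace _root_.Topology _root_.Set _root_.Function _root_.Filter
open scoped _root_.Manifold _root_.ContDiff
open Literature.Geometry.Kaehler (ComplexTorus)

/-! ### §1 Torsion bookkeeping -/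

section Torsion

variable {A B : Type*} [AddCommGroup A] [AddCommGroup B]

/-- An additive map with FINITE kernel reflects (and preserves) being of finite order: `f a` is torsion
iff `a` is (if `n • f a = 0`, `n > 0`, then `n • a` lies in the finite group `ker f`). [folklore] -/
private theorem isOfFinAddOrder_map_iff_of_finite_ker (f : A →+ B) (hf : (f.ker : Set A).Finite) (a : A) :
    IsOfFinAddOrder (f a) ↔ IsOfFinAddOrder a := by
  refine ⟨fun h => ?_, f.isOfFinAddOrder⟩
  obtain ⟨n, hn, hna⟩ := h.exists_nsmul_eq_zero
  have hmem : n • a ∈ f.ker := by rw [AddMonoidHom.mem_ker, map_nsmul, hna]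
  haveI : Finite f.ker := hf.to_subtype
  have h1 : IsOfFinAddOrder (⟨n • a, hmem⟩ : f.ker) := isOfFinAddOrder_of_finite _
  obtain ⟨m, hm, hmx⟩ := h1.exists_nsmul_eq_zero
  have hmna : m • (n • a) = 0 := by simpa using congrArg (Subtype.val : f.ker → A) hmx
  exact isOfFinAddOrder_iff_nsmul_eq_zero.2 ⟨m * n, Nat.mul_pos hm hn, by rw [mul_nsmul', hmna]⟩

/-- Multiplication by `N ≠ 0` reflects and preserves being of finite order. [folklore] -/
private theorem isOfFinAddOrder_nsmul_iff {N : ℕ} (hN : N ≠ 0) (a : A) :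
    IsOfFinAddOrder (N • a) ↔ IsOfFinAddOrder a := by
  refine ⟨fun h => ?_, fun h => h.nsmul⟩
  obtain ⟨n, hn, hna⟩ := h.exists_nsmul_eq_zero
  exact isOfFinAddOrder_iff_nsmul_eq_zero.2
    ⟨n * N, Nat.mul_pos hn (Nat.pos_of_ne_zero hN), by rw [mul_nsmul', hna]⟩

/-- Translation by a torsion element preserves being of finite order. [folklore] -/
private theorem isOfFinAddOrder_add_iff_of_isOfFinAddOrder {t : A} (ht : IsOfFinAddOrder t) (a : A) :
    IsOfFinAddOrder (a + t) ↔ IsOfFinAddOrder a := by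
  refine ⟨fun h => ?_, fun h => h.add ht⟩
  have h' := h.add ht.neg
  rwa [add_neg_cancel_right] at h'

end Torsion

/-! ### §2 (f) for the non-invertible finite étale maps of the model family: isogenies, `[N]`, deck translations -/

section Isogeny

variable {ι ι' : Type} [Fintype ι] [Fintype ι'] (Φ : (ι → ℝ) ≃L[ℝ] ℂ) (Φ' : (ι' → ℝ) ≃L[ℝ] ℂ)

/-- **(f) at the model for ISOGENY-TYPE maps** (MODEL-LEVEL): every additive map `f : T_{Φ'} → T_Φ` of
the compactifications with FINITE kernel — whose restriction `T_{Φ'} ∖ f⁻¹(0) → 𝔼_Φ` is, for a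
holomorphic surjective `f`, a finite étale morphism of punctured elliptic curves with several punctures
(e.g. `[N] : 𝕌_N → 𝔼`) — pulls back AND pushes forward the cuspidal torsion points of Cor 2.7 (b): for
`f u ≠ 0`, `f u` is a cuspidal torsion point of `𝔼_Φ` iff `u` is one of `𝔼_{Φ'}` (both are the non-zero
torsion points, (b).eq `mem_cuspidalTorsionPoints_iff`). [cite: MochizukiAbsTopIII2015, Corollary 2.7 (f) p.60] -/
theorem mem_cuspidalTorsionPoints_map_iff_of_finite_ker
    (f : ComplexTorus Φ' →+ ComplexTorus Φ) (hf : (f.ker : Set (ComplexTorus Φ')).Finite)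
    (u : ComplexTorus Φ') (hu : f u ≠ 0) (hu' : u ≠ 0) :
    (⟨f u, (mem_puncturedTorus_iff Φ _).2 hu⟩ : ↥(puncturedTorus Φ)) ∈
        cuspidalTorsionPoints ↥(puncturedTorus Φ) ↔
      (⟨u, (mem_puncturedTorus_iff Φ' _).2 hu'⟩ : ↥(puncturedTorus Φ')) ∈
        cuspidalTorsionPoints ↥(puncturedTorus Φ') := by
  rw [mem_cuspidalTorsionPoints_iff, mem_cuspidalTorsionPoints_iff]
  exact isOfFinAddOrder_map_iff_of_finite_ker f hf u

/-- **(f) for the covering leg `[N] : 𝕌_N → 𝔼` of the `N`-th elliptic cuspidalization diagram**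
(MODEL-LEVEL; `N ≠ 0`): a point `u ∈ 𝕌_N = T ∖ T[N]` maps under the finite étale covering `[N]` to a
cuspidal torsion point of `𝔼` iff it is itself a cuspidal torsion point of `𝔼` (read through the
open-immersion leg `𝕌_N ↪ 𝔼`) — `[N]` pulls back and pushes forward the torsion points of (b).
[cite: MochizukiAbsTopIII2015, Corollary 2.7 (f) p.60] -/
theorem nsmulCov_mem_cuspidalTorsionPoints_iff {N : ℕ} (hN : N ≠ 0) (u : ↥(nsmulLocus Φ N)) :
    nsmulCov Φ N u ∈ cuspidalTorsionPoints ↥(puncturedTorus Φ) ↔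
      nsmulImm Φ N u ∈ cuspidalTorsionPoints ↥(puncturedTorus Φ) := by
  rw [mem_cuspidalTorsionPoints_iff, mem_cuspidalTorsionPoints_iff, coe_nsmulCov, coe_nsmulImm]
  exact isOfFinAddOrder_nsmul_iff hN _

/-- Set form of `nsmulCov_mem_cuspidalTorsionPoints_iff`: along the diagram `𝔼 ↩ 𝕌_N → 𝔼` the two
pull-backs of the cuspidal torsion points of `𝔼` to `𝕌_N` COINCIDE. [cite: MochizukiAbsTopIII2015, Corollary 2.7 (f) p.60] -/
theorem preimage_nsmulCov_cuspidalTorsionPoints {N : ℕ} (hN : N ≠ 0) :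
    nsmulCov Φ N ⁻¹' cuspidalTorsionPoints ↥(puncturedTorus Φ) =
      nsmulImm Φ N ⁻¹' cuspidalTorsionPoints ↥(puncturedTorus Φ) := by
  ext u
  exact nsmulCov_mem_cuspidalTorsionPoints_iff Φ hN u

omit [Fintype ι] in
/-- `T = (ℝ/ℤ)^ι` is divisible: every point is `N` times some point (`N ≠ 0`). [folklore] -/
private theorem exists_nsmul_eq {N : ℕ} (hN : N ≠ 0) (y : ComplexTorus Φ) :
    ∃ u : ComplexTorus Φ, N • u = y := by
  refine ⟨Literature.Geometry.Kaehler.ComplexTorus.proj Φ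
    (fun i => (N : ℝ)⁻¹ * Literature.Geometry.Kaehler.ComplexTorus.lift Φ y i), ?_⟩
  conv_rhs => rw [← Literature.Geometry.Kaehler.ComplexTorus.proj_lift Φ y]
  funext i
  change N • ((((N : ℝ)⁻¹ * Literature.Geometry.Kaehler.ComplexTorus.lift Φ y i : ℝ)) :
      AddCircle (1 : ℝ)) =
    (((Literature.Geometry.Kaehler.ComplexTorus.lift Φ y i : ℝ)) : AddCircle (1 : ℝ))
  rw [← AddCircle.coe_nsmul, nsmul_eq_mul, ← mul_assoc, mul_inv_cancel₀ (Nat.cast_ne_zero.2 hN),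
    one_mul]

/-- **`[N]` maps the cuspidal torsion points of `𝕌_N` ONTO the cuspidal torsion points of `𝔼`**
(push-forward is surjective: `T` is divisible and an `N`-th "root" of a non-zero torsion point is a
non-zero torsion point off `T[N]`). [cite: MochizukiAbsTopIII2015, Corollary 2.7 (f) p.60] -/
theorem image_nsmulCov_cuspidalTorsionPoints {N : ℕ} (hN : N ≠ 0) :
    nsmulCov Φ N '' (nsmulImm Φ N ⁻¹' cuspidalTorsionPoints ↥(puncturedTorus Φ)) =
      cuspidalTorsionPoints ↥(puncturedTorus Φ) := by
  refine Set.Subset.antisymm ?_ fun y hy => ?_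
  · rintro _ ⟨u, hu, rfl⟩
    exact (nsmulCov_mem_cuspidalTorsionPoints_iff Φ hN u).2 hu
  · obtain ⟨u, hu⟩ := exists_nsmul_eq Φ hN (y : ComplexTorus Φ)
    have huN : u ∈ nsmulLocus Φ N := by
      rw [mem_nsmulLocus_iff, hu]
      exact (mem_puncturedTorus_iff Φ _).1 y.2
    have hcov : nsmulCov Φ N ⟨u, huN⟩ = y := Subtype.ext hu
    refine ⟨⟨u, huN⟩, ?_, hcov⟩
    rw [Set.mem_preimage, ← nsmulCov_mem_cuspidalTorsionPoints_iff Φ hN, hcov]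
    exact hy

/-- **The deck transformations of `[N] : 𝕌_N → 𝔼` preserve the cuspidal torsion points** (they are the
translations by the `N`-torsion points, (b).3♯; «the group structure on these torsion points [which is
induced by the group structure of the Galois group `Gal(U/E)`]»): `φ(u)` is a cuspidal torsion point of
`𝔼` iff `u` is. [cite: MochizukiAbsTopIII2015, Corollary 2.7 (f) p.60] -/
theorem mem_cuspidalTorsionPoints_deck_iff {N : ℕ} (hN : N ≠ 0)
    {φ : ↥(nsmulLocus Φ N) ≃ₜ ↥(nsmulLocus Φ N)} (hφ : φ ∈ deckGroup (nsmulCov Φ N))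
    (u : ↥(nsmulLocus Φ N)) :
    nsmulImm Φ N (φ u) ∈ cuspidalTorsionPoints ↥(puncturedTorus Φ) ↔
      nsmulImm Φ N u ∈ cuspidalTorsionPoints ↥(puncturedTorus Φ) := by
  rw [mem_cuspidalTorsionPoints_iff, mem_cuspidalTorsionPoints_iff, coe_nsmulImm, coe_nsmulImm]
  have ht : IsOfFinAddOrder (((φ u : ↥(nsmulLocus Φ N)) : ComplexTorus Φ) - (u : ComplexTorus Φ)) :=
    isOfFinAddOrder_iff_nsmul_eq_zero.2
      ⟨N, Nat.pos_of_ne_zero hN, nsmul_sub_eq_zero_of_mem_deckGroup Φ hφ u⟩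
  have heq : ((φ u : ↥(nsmulLocus Φ N)) : ComplexTorus Φ) =
      (u : ComplexTorus Φ) + ((((φ u : ↥(nsmulLocus Φ N)) : ComplexTorus Φ) - (u : ComplexTorus Φ))) := by
    abel
  rw [heq]
  exact isOfFinAddOrder_add_iff_of_isOfFinAddOrder ht _

/-- **`[N]` is compatible with the group law of `T ⊃ 𝔼`** (the group law of (c) at the model): for
`u, v ∈ 𝕌_N` with `u + v ∈ 𝕌_N`, `[N](u + v) = [N]u + [N]v` in `T`. [cite: MochizukiAbsTopIII2015, Corollary 2.7 (f) p.60] -/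
theorem coe_nsmulCov_add (N : ℕ) (u v : ↥(nsmulLocus Φ N))
    (huv : (u : ComplexTorus Φ) + (v : ComplexTorus Φ) ∈ nsmulLocus Φ N) :
    ((nsmulCov Φ N ⟨(u : ComplexTorus Φ) + v, huv⟩ : ↥(puncturedTorus Φ)) : ComplexTorus Φ) =
      ((nsmulCov Φ N u : ↥(puncturedTorus Φ)) : ComplexTorus Φ) + (nsmulCov Φ N v : ↥(puncturedTorus Φ)) := by
  simp only [coe_nsmulCov, smul_add]

end Isogeny

end HolomorphicEllipticCuspidalization

end Literature.AnabelianGeometry.AbsoluteAnabelian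

end
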